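import Literature.Barriers.PneNP.CorrelationPolytopeXCLowerBound
import Literature.Barriers.PneNP.ExtendedFormulationLinearImage
import Literature.Combinatorics.Optimization.CutPolytopeMinorMonotone
import Literature.Combinatorics.Optimization.CutPolytopeMinorMonotoneProofs
import HarnessLib

/-!
# `xc(CUT(n+1)) = xc(COR(n)) ≥ (3/2)ⁿ − 1` (De Simone; FMPTW Theorems 5 and 7)

[cite: FioriniEtAl2015, §3.2, Thm. 5 ([DeSimone90]) and Thm. 7 (arXiv:1111.0837, p. 9)]

Fiorini–Massar–Pokutta–Tiwary–de Wolf, *Exponential lower bounds for polytopes in combinatorial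
optimization*, J. ACM 62 (2015), §3.2:

* **Theorem 5** ([DeSimone90]). "For all `n`, `COR(n)` is linearly isomorphic to `CUT(n+1)`."
* **Theorem 7.** "There exists some constant `C > 0` such that, for all `n`,
  `xc(CUT(n+1)) = xc(COR(n)) ≥ 2^{Cn}`.  In particular, the extension complexity of `CUT(n)` is
  `2^{Ω(n)}`."  ("The equality is implied by Theorem 5.")

Here `CUT(m) = conv{χ^{δ(X)} : X ⊆ V_m} ⊆ ℝ^{E(K_m)}` is the tree's
`cutPolytope (⊤ : SimpleGraph (Fin m))` (`CutPolytopeMinorMonotone.lean`; equal by `rfl` to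
`conv(range cutVector)` of `CutTspStabPsdRank.lean`, `cutPolytope_top`) and
`COR(n) = conv{b bᵀ}` is `FixedSizePsdRank.corPolytope n ⊆ ℝ^{n × n}`.

## What is proved (everything; no named facts)

* `DeSimoneXC.covMap n : ℝ^{E(K_{n+1})} →ₗ ℝ^{n×n}`, De Simone's covariance map
  `y_{ii} = x_{i,n+1}`, `y_{ij} = (x_{i,n+1} + x_{j,n+1} − x_{ij})/2`, assembled from the coefficient
  vectors `DeSimone.monoVec` of `CutTspStabPsdRank.lean` (where the map is used on psd
  factorisations of slack matrices, LRS Prop. 5.2), and its inverse on the polytopes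
  `DeSimoneXC.corToCut n : ℝ^{n×n} →ₗ ℝ^{E(K_{n+1})}`, `x_{i,n+1} = y_{ii}`,
  `x_{ij} = y_{ii} + y_{jj} − y_{ij} − y_{ji}`;
* **Theorem 5**: `covMap_image : covMap(CUT(n+1)) = COR(n)`, `corToCut_image : corToCut(COR(n)) =
  CUT(n+1)`, and the two maps are mutually inverse on the two polytopes
  (`corToCut_covMap_of_mem`, `covMap_corToCut_of_mem`) — `FioriniEtAl2015_thm5`;
* **Theorem 7**: `hasEFOfSize_cut_iff_cor : xc`-equality in the currency of `HasEFOfSize`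
  (every size of an EF of one is a size of an EF of the other, by `HasEFOfSize.image_linearMap`),
  and `cutPolytope_complete_xc_ge : HasEFOfSize (CUT(n+1)) r → (3/2)ⁿ ≤ r + 1` from the tree's
  Kaibel–Weltge form `corPolytope_xc_ge` of the bound for `COR(n)` — `FioriniEtAl2015_thm7`.
-/

noncomputable section

namespace Literature.Barriers.PneNP

open Matrix Finset
open Literature.Combinatorics.Optimization (cutVector cutPolytope cutVec)
open Literature.Combinatorics.Optimization.DeSimone (edgeLast edgePair monoVec cutCoord cutOf
  monoVec_dotProduct cutVector_edgePair cutCoord_cutOf)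
open Literature.Combinatorics.Optimization.FixedSizePsdRank (Cube bvec vecOuter corPolytope
  bvec_zero_or_one)

/-- `CUT(m)` of `CutPolytopeMinorMonotone.lean` (the cut polytope of `K_m`) is the convex hull of the
cut vectors `cutVector` of `CutTspStabPsdRank.lean`.
[cite: FioriniEtAl2015, §3.2 (arXiv p. 9, definition of `CUT(n)`)] -/
theorem cutPolytope_top (m : ℕ) :
    cutPolytope (⊤ : SimpleGraph (Fin m)) = convexHull ℝ (Set.range (cutVector (n := m))) := rfl

namespace DeSimoneXC

variable {n : ℕ}

/-- Entries `x^S_i = δ(S)_{i,n+1}` of a cut vector are `0/1`. [cite: FioriniEtAl2015, §3.2] -/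
theorem cutCoord_zero_or_one (S : Finset (Fin (n + 1))) (i : Fin n) :
    cutCoord S i = 0 ∨ cutCoord S i = 1 := by
  unfold cutCoord cutVector
  split_ifs <;> simp

/-! ### The covariance map `CUT(n+1) → COR(n)` -/

variable (n) in
/-- De Simone's covariance map `ℝ^{E(K_{n+1})} → ℝ^{n×n}`: `y_{ij} = ⟨monoVec i j, x⟩`, i.e.
`y_{ii} = x_{i,n+1}` and `y_{ij} = (x_{i,n+1} + x_{j,n+1} − x_{ij})/2` (`i ≠ j`).
[cite: FioriniEtAl2015, §3.2, Thm. 5 ([DeSimone90]) (arXiv p. 9)] -/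
def covMap : ((⊤ : SimpleGraph (Fin (n + 1))).edgeSet → ℝ) →ₗ[ℝ] (Fin (n * n) → ℝ) where
  toFun x q := monoVec (finProdFinEquiv.symm q).1 (finProdFinEquiv.symm q).2 ⬝ᵥ x
  map_add' x y := by
    funext q
    simp only [dotProduct_add, Pi.add_apply]
  map_smul' c x := by
    funext q
    simp only [dotProduct_smul, smul_eq_mul, Pi.smul_apply, RingHom.id_apply]

/-- `covMap (δ(S)) = x^S (x^S)ᵀ`. [cite: FioriniEtAl2015, §3.2, Thm. 5 (arXiv p. 9)] -/
theorem covMap_cutVector (S : Finset (Fin (n + 1))) :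
    covMap n (cutVector S) = vecOuter n (cutCoord S) := by
  funext q
  show monoVec (finProdFinEquiv.symm q).1 (finProdFinEquiv.symm q).2 ⬝ᵥ cutVector S = _
  rw [monoVec_dotProduct]
  rfl

/-- The bit string of a cut: `b_i = 1 ↔ x^S_i = 1`. [cite: FioriniEtAl2015, §3.2] -/
def bitsOfCut (S : Finset (Fin (n + 1))) : Cube n := fun i => decide (cutCoord S i = 1)

/-- `bvec (bitsOfCut S) = x^S`. [cite: FioriniEtAl2015, §3.2] -/
theorem bvec_bitsOfCut (S : Finset (Fin (n + 1))) : bvec (bitsOfCut S) = cutCoord S := by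
  funext i
  rcases cutCoord_zero_or_one S i with h | h <;> simp [bvec, bitsOfCut, h]

/-- **Theorem 5, first half**: the covariance map sends `CUT(n+1)` onto `COR(n)`.
[cite: FioriniEtAl2015, §3.2, Thm. 5 ([DeSimone90]) (arXiv p. 9)] -/
theorem covMap_image (n : ℕ) :
    covMap n '' cutPolytope (⊤ : SimpleGraph (Fin (n + 1))) = corPolytope n := by
  rw [cutPolytope_top, LinearMap.image_convexHull, ← Set.range_comp]
  unfold corPolytope
  congr 1
  apply Set.Subset.antisymm
  · rintro _ ⟨S, rfl⟩
    refine ⟨bitsOfCut S, ?_⟩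
    simp only [Function.comp_apply, covMap_cutVector, bvec_bitsOfCut]
  · rintro _ ⟨b, rfl⟩
    refine ⟨cutOf ⟨bvec b, bvec_zero_or_one b⟩, ?_⟩
    simp only [Function.comp_apply, covMap_cutVector]
    congr 1
    funext i
    exact cutCoord_cutOf _ i

/-! ### The inverse map `COR(n) → CUT(n+1)` -/

/-- The position of the entry `(i, j)` in `ℝ^{n × n} = ℝ^{n²}`. [cite: FioriniEtAl2015, §3.2] -/
abbrev idx (i j : Fin n) : Fin (n * n) := finProdFinEquiv (i, j)

/-- `⟨e_{ij}, x xᵀ⟩ = x_i x_j`. [cite: FioriniEtAl2015, §3.2] -/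
theorem single_idx_dotProduct_vecOuter (i j : Fin n) (x : Fin n → ℝ) :
    Pi.single (idx i j) (1 : ℝ) ⬝ᵥ vecOuter n x = x i * x j := by
  rw [single_dotProduct, one_mul]
  simp [vecOuter]

/-- Coefficient vector reading the diagonal entry `y_{uu}` (`0` at the apex `u = n+1`).
[cite: FioriniEtAl2015, §3.2, Thm. 5 (arXiv p. 9)] -/
def diagVec (u : Fin (n + 1)) : Fin (n * n) → ℝ :=
  if h : u = Fin.last n then 0 else Pi.single (idx (u.castPred h) (u.castPred h)) 1

/-- Coefficient vector reading the entry `y_{uv}` (`0` if `u` or `v` is the apex).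
[cite: FioriniEtAl2015, §3.2, Thm. 5 (arXiv p. 9)] -/
def offVec (u v : Fin (n + 1)) : Fin (n * n) → ℝ :=
  if hu : u = Fin.last n then 0 else if hv : v = Fin.last n then 0
  else Pi.single (idx (u.castPred hu) (v.castPred hv)) 1

/-- `diagVec` at a non-apex vertex reads `y_{ii}`. [cite: FioriniEtAl2015, §3.2, Thm. 5 (arXiv p. 9)] -/
theorem diagVec_castSucc (i : Fin n) : diagVec (Fin.castSucc i) = Pi.single (idx i i) 1 := by
  unfold diagVec
  rw [dif_neg (Fin.castSucc_ne_last i), Fin.castPred_castSucc]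

/-- `diagVec` vanishes at the apex. [cite: FioriniEtAl2015, §3.2, Thm. 5 (arXiv p. 9)] -/
theorem diagVec_last : diagVec (Fin.last n) = 0 := by
  unfold diagVec
  rw [dif_pos rfl]

/-- `offVec` at two non-apex vertices reads `y_{ij}`. [cite: FioriniEtAl2015, §3.2, Thm. 5 (arXiv p. 9)] -/
theorem offVec_castSucc (i j : Fin n) :
    offVec (Fin.castSucc i) (Fin.castSucc j) = Pi.single (idx i j) 1 := by
  unfold offVec
  rw [dif_neg (Fin.castSucc_ne_last i), dif_neg (Fin.castSucc_ne_last j), Fin.castPred_castSucc,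
    Fin.castPred_castSucc]

/-- `offVec` vanishes when the first vertex is the apex. [cite: FioriniEtAl2015, §3.2, Thm. 5 (arXiv p. 9)] -/
theorem offVec_last_left (v : Fin (n + 1)) : offVec (Fin.last n) v = 0 := by
  unfold offVec
  rw [dif_pos rfl]

/-- `offVec` vanishes when the second vertex is the apex. [cite: FioriniEtAl2015, §3.2, Thm. 5 (arXiv p. 9)] -/
theorem offVec_last_right (u : Fin (n + 1)) : offVec u (Fin.last n) = 0 := by
  unfold offVec
  split_ifs with h1 h2
  · rfl
  · rfl
  · exact absurd rfl h2

/-- The coefficient vector of the edge `uv` of `K_{n+1}`: `x_{uv} = y_{uu} + y_{vv} − y_{uv} − y_{vu}`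
(with `y_{u,n+1} := 0`, `y_{n+1,n+1} := 0`). [cite: FioriniEtAl2015, §3.2, Thm. 5 (arXiv p. 9)] -/
def edgeCoeff : Sym2 (Fin (n + 1)) → (Fin (n * n) → ℝ) :=
  Sym2.lift ⟨fun u v => diagVec u + diagVec v - offVec u v - offVec v u, fun u v => by abel⟩

/-- `edgeCoeff` on a pair, unfolded. [cite: FioriniEtAl2015, §3.2, Thm. 5 (arXiv p. 9)] -/
theorem edgeCoeff_mk (u v : Fin (n + 1)) :
    edgeCoeff s(u, v) = diagVec u + diagVec v - offVec u v - offVec v u := rfl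

variable (n) in
/-- The inverse of the covariance map on the polytopes, `ℝ^{n×n} → ℝ^{E(K_{n+1})}`:
`x_{i,n+1} = y_{ii}`, `x_{ij} = y_{ii} + y_{jj} − y_{ij} − y_{ji}`.
[cite: FioriniEtAl2015, §3.2, Thm. 5 ([DeSimone90]) (arXiv p. 9)] -/
def corToCut : (Fin (n * n) → ℝ) →ₗ[ℝ] ((⊤ : SimpleGraph (Fin (n + 1))).edgeSet → ℝ) where
  toFun y e := edgeCoeff (e : Sym2 (Fin (n + 1))) ⬝ᵥ y
  map_add' x y := by
    funext e
    simp only [dotProduct_add, Pi.add_apply]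
  map_smul' c x := by
    funext e
    simp only [dotProduct_smul, smul_eq_mul, Pi.smul_apply, RingHom.id_apply]

/-- `corToCut (x xᵀ) = δ(S)` whenever `x = x^S ∈ {0,1}ⁿ` (`δ(S)_{ij} = x_i + x_j − 2 x_i x_j`,
`δ(S)_{i,n+1} = x_i`). [cite: FioriniEtAl2015, §3.2, Thm. 5 (arXiv p. 9)] -/
theorem corToCut_vecOuter (S : Finset (Fin (n + 1))) :
    corToCut n (vecOuter n (cutCoord S)) = cutVector S := by
  funext e
  obtain ⟨e, he⟩ := e
  induction e using Sym2.ind with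
  | _ u v =>
    have huv : u ≠ v := by
      rw [SimpleGraph.mem_edgeSet, SimpleGraph.top_adj] at he
      exact he
    show edgeCoeff s(u, v) ⬝ᵥ vecOuter n (cutCoord S) = cutVector S ⟨s(u, v), he⟩
    rw [edgeCoeff_mk, sub_dotProduct, sub_dotProduct, add_dotProduct]
    rcases Fin.eq_castSucc_or_eq_last u with ⟨i, rfl⟩ | rfl <;>
      rcases Fin.eq_castSucc_or_eq_last v with ⟨j, rfl⟩ | rfl
    · have hij : i ≠ j := fun h => huv (by rw [h])
      have he' : (⟨s(Fin.castSucc i, Fin.castSucc j), he⟩ :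
          (⊤ : SimpleGraph (Fin (n + 1))).edgeSet) = edgePair i j hij := rfl
      rw [diagVec_castSucc, diagVec_castSucc, offVec_castSucc, offVec_castSucc,
        single_idx_dotProduct_vecOuter, single_idx_dotProduct_vecOuter,
        single_idx_dotProduct_vecOuter, single_idx_dotProduct_vecOuter, he',
        cutVector_edgePair]
      rcases cutCoord_zero_or_one S i with hi | hi <;>
        rcases cutCoord_zero_or_one S j with hj | hj <;> rw [hi, hj] <;> norm_num
    · have he' : (⟨s(Fin.castSucc i, Fin.last n), he⟩ :
          (⊤ : SimpleGraph (Fin (n + 1))).edgeSet) = edgeLast i := rfl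
      rw [diagVec_castSucc, diagVec_last, offVec_last_right, offVec_last_left,
        single_idx_dotProduct_vecOuter, zero_dotProduct, he']
      show _ = cutCoord S i
      rcases cutCoord_zero_or_one S i with hi | hi <;> rw [hi] <;> norm_num
    · have he' : (⟨s(Fin.last n, Fin.castSucc j), he⟩ :
          (⊤ : SimpleGraph (Fin (n + 1))).edgeSet) = edgeLast j := Subtype.ext Sym2.eq_swap
      rw [diagVec_castSucc, diagVec_last, offVec_last_right, offVec_last_left,
        single_idx_dotProduct_vecOuter, zero_dotProduct, he']
      show _ = cutCoord S j
      rcases cutCoord_zero_or_one S j with hj | hj <;> rw [hj] <;> norm_num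
    · exact absurd rfl huv

/-- `corToCut (b bᵀ) = δ(S_b)`. [cite: FioriniEtAl2015, §3.2, Thm. 5 (arXiv p. 9)] -/
theorem corToCut_vecOuter_bvec (b : Cube n) :
    corToCut n (vecOuter n (bvec b)) = cutVector (cutOf ⟨bvec b, bvec_zero_or_one b⟩) := by
  rw [← corToCut_vecOuter]
  congr 2
  funext i
  exact (cutCoord_cutOf ⟨bvec b, bvec_zero_or_one b⟩ i).symm

/-- **Theorem 5, second half**: the inverse map sends `COR(n)` onto `CUT(n+1)`.
[cite: FioriniEtAl2015, §3.2, Thm. 5 ([DeSimone90]) (arXiv p. 9)] -/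
theorem corToCut_image (n : ℕ) :
    corToCut n '' corPolytope n = cutPolytope (⊤ : SimpleGraph (Fin (n + 1))) := by
  unfold corPolytope
  rw [cutPolytope_top, LinearMap.image_convexHull, ← Set.range_comp]
  congr 1
  apply Set.Subset.antisymm
  · rintro _ ⟨b, rfl⟩
    exact ⟨cutOf ⟨bvec b, bvec_zero_or_one b⟩, (corToCut_vecOuter_bvec b).symm⟩
  · rintro _ ⟨S, rfl⟩
    refine ⟨bitsOfCut S, ?_⟩
    simp only [Function.comp_apply, bvec_bitsOfCut, corToCut_vecOuter]

/-- `corToCut ∘ covMap = id` on the cut vectors. [cite: FioriniEtAl2015, §3.2, Thm. 5] -/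
theorem corToCut_covMap_cutVector (S : Finset (Fin (n + 1))) :
    corToCut n (covMap n (cutVector S)) = cutVector S := by
  rw [covMap_cutVector, corToCut_vecOuter]

/-- `covMap ∘ corToCut = id` on the matrices `b bᵀ`. [cite: FioriniEtAl2015, §3.2, Thm. 5] -/
theorem covMap_corToCut_vecOuter (b : Cube n) :
    covMap n (corToCut n (vecOuter n (bvec b))) = vecOuter n (bvec b) := by
  rw [corToCut_vecOuter_bvec, covMap_cutVector]
  congr 1
  funext i
  exact cutCoord_cutOf _ i

/-- A linear map fixing a set fixes its convex hull. [cite: FioriniEtAl2015, §3.2, Thm. 5] -/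
theorem eq_of_mem_convexHull_of_forall_eq {ι : Type} (f : (ι → ℝ) →ₗ[ℝ] (ι → ℝ))
    {s : Set (ι → ℝ)} (hs : ∀ x ∈ s, f x = x) {x : ι → ℝ} (hx : x ∈ convexHull ℝ s) : f x = x := by
  have hconv : Convex ℝ {y : ι → ℝ | f y = y} := by
    intro y hy z hz a c _ _ _
    simp only [Set.mem_setOf_eq] at hy hz ⊢
    rw [map_add, map_smul, map_smul, hy, hz]
  exact convexHull_min hs hconv hx

/-- `corToCut ∘ covMap = id` on `CUT(n+1)`. [cite: FioriniEtAl2015, §3.2, Thm. 5 (arXiv p. 9)] -/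
theorem corToCut_covMap_of_mem {x : (⊤ : SimpleGraph (Fin (n + 1))).edgeSet → ℝ}
    (hx : x ∈ cutPolytope (⊤ : SimpleGraph (Fin (n + 1)))) : corToCut n (covMap n x) = x := by
  refine eq_of_mem_convexHull_of_forall_eq ((corToCut n).comp (covMap n)) ?_ hx
  rintro _ ⟨S, rfl⟩
  exact corToCut_covMap_cutVector S

/-- `covMap ∘ corToCut = id` on `COR(n)`. [cite: FioriniEtAl2015, §3.2, Thm. 5 (arXiv p. 9)] -/
theorem covMap_corToCut_of_mem {y : Fin (n * n) → ℝ} (hy : y ∈ corPolytope n) :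
    covMap n (corToCut n y) = y := by
  refine eq_of_mem_convexHull_of_forall_eq ((covMap n).comp (corToCut n)) ?_ hy
  rintro _ ⟨b, rfl⟩
  exact covMap_corToCut_vecOuter b

end DeSimoneXC

open DeSimoneXC

/-- **FMPTW Theorem 5** ([DeSimone90]): "`COR(n)` is linearly isomorphic to `CUT(n+1)`" — the linear
maps `covMap n` (De Simone's covariance map) and `corToCut n` restrict to mutually inverse
bijections `CUT(n+1) ⇄ COR(n)`. [cite: FioriniEtAl2015, §3.2, Thm. 5 ([DeSimone90]) (arXiv p. 9)] -/
theorem FioriniEtAl2015_thm5 (n : ℕ) :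
    covMap n '' cutPolytope (⊤ : SimpleGraph (Fin (n + 1))) = corPolytope n ∧
      corToCut n '' corPolytope n = cutPolytope (⊤ : SimpleGraph (Fin (n + 1))) ∧
      (∀ x ∈ cutPolytope (⊤ : SimpleGraph (Fin (n + 1))), corToCut n (covMap n x) = x) ∧
      ∀ y ∈ corPolytope n, covMap n (corToCut n y) = y :=
  ⟨covMap_image n, corToCut_image n, fun _ hx => corToCut_covMap_of_mem hx,
    fun _ hy => covMap_corToCut_of_mem hy⟩

/-- `xc(CUT(n+1)) = xc(COR(n))` in the currency of `HasEFOfSize`: the two polytopes have extended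
formulations of exactly the same sizes (linear images, both ways).
[cite: FioriniEtAl2015, §3.2, Thm. 7 ("The equality is implied by Theorem 5"; arXiv p. 9)] -/
theorem hasEFOfSize_cut_iff_cor (n r : ℕ) :
    HasEFOfSize (cutPolytope (⊤ : SimpleGraph (Fin (n + 1)))) r ↔ HasEFOfSize (corPolytope n) r := by
  constructor
  · intro h
    have := h.image_linearMap (covMap n)
    rwa [covMap_image] at this
  · intro h
    have := h.image_linearMap (corToCut n)
    rwa [corToCut_image] at this

/-- **FMPTW Theorem 7** for the cut polytope, explicit form: every extended formulation of
`CUT(n+1) = CUT□(K_{n+1})` has size `r ≥ (3/2)ⁿ − 1` (`xc(CUT(n)) = 2^{Ω(n)}`), by Theorem 5 and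
the tree's Kaibel–Weltge form `corPolytope_xc_ge` of the bound for `COR(n)`.
[cite: FioriniEtAl2015, §3.2, Thm. 7 (arXiv p. 9)] -/
theorem cutPolytope_complete_xc_ge {n r : ℕ}
    (h : HasEFOfSize (cutPolytope (⊤ : SimpleGraph (Fin (n + 1)))) r) :
    (3 / 2 : ℝ) ^ n ≤ r + 1 :=
  corPolytope_xc_ge ((hasEFOfSize_cut_iff_cor n r).mp h)

/-- **FMPTW Theorem 7**, as printed (with the tree's explicit constant): `xc(CUT(n+1)) =
xc(COR(n))` (same EF sizes) and both are `≥ (3/2)ⁿ − 1`.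
[cite: FioriniEtAl2015, §3.2, Thm. 7 (arXiv p. 9)] -/
theorem FioriniEtAl2015_thm7 (n : ℕ) :
    (∀ r : ℕ, HasEFOfSize (cutPolytope (⊤ : SimpleGraph (Fin (n + 1)))) r ↔
        HasEFOfSize (corPolytope n) r) ∧
      (∀ r : ℕ, HasEFOfSize (corPolytope n) r → (3 / 2 : ℝ) ^ n ≤ r + 1) ∧
      ∀ r : ℕ, HasEFOfSize (cutPolytope (⊤ : SimpleGraph (Fin (n + 1)))) r →
        (3 / 2 : ℝ) ^ n ≤ r + 1 :=
  ⟨hasEFOfSize_cut_iff_cor n, fun _ h => corPolytope_xc_ge h, fun _ h => cutPolytope_complete_xc_ge h⟩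

end Literature.Barriers.PneNP

/-! ## Appended: Avis–Tiwary 2015, Corollaries 6 and 7 — cut polytopes of graphs with a clique minor;
the Bell inequality polytopes `CUT□(K_{1,n,n})`

[cite: AvisTiwary2015, §4.1, Cor. 6 and Cor. 7 (arXiv:1302.2340 p. 13; lit-read p0013 L26–43)]

D. Avis, H. R. Tiwary, *On the extension complexity of combinatorial polytopes*, Math. Program.
(2015), §4.1: "Using the above theorem [Thm. 12: `H` a minor of `G` ⇒ `xc(CUT□(G)) ≥ xc(CUT□(H))`]
together with the result of [FMPTW] that the extension complexity of `CUT□(K_n)` is at least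
`2^{Ω(n)}` we get the following result.  **Corollary 6.** The extension complexity of `CUT□(G)` for
a graph `G` with a `K_n` minor is at least `2^{Ω(n)}`."  "**Corollary 7.** The extension complexity
of `CUT□(K_{1,n,n})` is at least `2^{Ω(n)}`.  *Proof.* Pick any matching of size `n` between the
vertices in each of the two parts of cardinality `n`.  Contracting the edges in this matching yields
`K_{n+1}` and the result follows."  (`CUT□(K_{1,n,n})` is the Bell inequality polytope of the
introduction, §1.)  Both PROVED here from the tree's discharge `AvisTiwary2015_thm12_holds` of
Theorem 12 (`CutPolytopeMinorMonotoneProofs.lean`) and `cutPolytope_complete_xc_ge` above, with the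
explicit constant `(3/2)ⁿ − 1` for a `K_{n+1}` minor; `K_{1,n,n}` is `bellGraph n`, the complete
tripartite graph on `Option (Fin n × Bool)` (apex `none`, parts `(·, true)` and `(·, false)`), and
the contraction of the matching `{(i,true),(i,false)}` is the branch map `bellBranch`.
-/

namespace Literature.Barriers.PneNP

open Literature.Combinatorics.Optimization (cutPolytope AvisTiwary2015_thm12_holds)
open Literature.Combinatorics.SimpleGraph (IsMinor)

/-- **Avis–Tiwary Corollary 6** (explicit form): if `K_{n+1}` is a minor of `G`, every extended
formulation of `CUT□(G)` has size `r ≥ (3/2)ⁿ − 1` ("at least `2^{Ω(n)}`").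
[cite: AvisTiwary2015, §4.1, Cor. 6 (arXiv p. 13, lit-read p0013 L28–30)] -/
theorem AvisTiwary2015_cor6 {β : Type} [Fintype β] [DecidableEq β] (G : SimpleGraph β)
    [DecidableRel G.Adj] {n : ℕ} (hminor : IsMinor (⊤ : SimpleGraph (Fin (n + 1))) G) {r : ℕ}
    (h : HasEFOfSize (cutPolytope G) r) : (3 / 2 : ℝ) ^ n ≤ r + 1 :=
  cutPolytope_complete_xc_ge (AvisTiwary2015_thm12_holds (Fin (n + 1)) β ⊤ G hminor r h)

/-- The three parts of the complete tripartite graph `K_{1,n,n}` on `Option (Fin n × Bool)`: the apex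
`none` (part `0`), the vertices `(i, true)` (part `1`) and `(i, false)` (part `2`).
[cite: AvisTiwary2015, §1 and §4.1, Cor. 7 (arXiv pp. 3, 13)] -/
def bellPart (n : ℕ) : Option (Fin n × Bool) → Fin 3
  | none => 0
  | some (_, true) => 1
  | some (_, false) => 2

/-- The complete tripartite graph `K_{1,n,n}` (two vertices are adjacent iff they lie in different
parts), whose cut polytope is the Bell inequality polytope (an `abbrev`, so that the decidability of
adjacency is inherited from `comap`).
[cite: AvisTiwary2015, §1 ("the cut polytope of the complete tripartite graph `K_{1,n,n}`") and §4.1, Cor. 7 (arXiv pp. 3, 13)] -/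
abbrev bellGraph (n : ℕ) : SimpleGraph (Option (Fin n × Bool)) :=
  (⊤ : SimpleGraph (Fin 3)).comap (bellPart n)

/-- Adjacency in `K_{1,n,n}`: different parts. [cite: AvisTiwary2015, §4.1, Cor. 7 (arXiv p. 13)] -/
theorem bellGraph_adj {n : ℕ} (x y : Option (Fin n × Bool)) :
    (bellGraph n).Adj x y ↔ bellPart n x ≠ bellPart n y := by
  simp [bellGraph]

/-- `K_{1,n,n}` has `2n + 1` vertices. [cite: AvisTiwary2015, §4.1, Cor. 7 (arXiv p. 13)] -/
theorem card_bellGraph_vert (n : ℕ) : Fintype.card (Option (Fin n × Bool)) = 2 * n + 1 := by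
  simp [Fintype.card_option, Fintype.card_prod, mul_comm]

/-- The branch map contracting the matching `{(i, true), (i, false)}` (`i < n`) of `K_{1,n,n}`:
the apex is the branch set of the last vertex of `K_{n+1}`, the pair `{(i,true),(i,false)}` that of
vertex `i`. [cite: AvisTiwary2015, §4.1, proof of Cor. 7 (arXiv p. 13)] -/
def bellBranch (n : ℕ) : Option (Fin n × Bool) → Option (Fin (n + 1))
  | none => some (Fin.last n)
  | some (i, _) => some (Fin.castSucc i)

/-- "Contracting the edges in this matching yields `K_{n+1}`": `K_{n+1}` is a minor of `K_{1,n,n}`.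
[cite: AvisTiwary2015, §4.1, proof of Cor. 7 (arXiv p. 13)] -/
theorem isMinor_top_bellGraph (n : ℕ) : IsMinor (⊤ : SimpleGraph (Fin (n + 1))) (bellGraph n) := by
  refine ⟨bellBranch n, fun u => ?_, fun x y hxy hx => ?_, fun u v huv => ?_⟩
  · -- every branch set is nonempty
    rcases Fin.eq_castSucc_or_eq_last u with ⟨i, rfl⟩ | rfl
    · exact ⟨some (i, true), rfl⟩
    · exact ⟨none, rfl⟩
  · -- branch sets are connected (a vertex, or a matching edge)
    by_cases he : x = y
    · subst he
      exact ⟨SimpleGraph.Walk.nil, fun z hz => by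
        rw [SimpleGraph.Walk.support_nil, List.mem_singleton] at hz
        rw [hz]⟩
    · have hadj : (bellGraph n).Adj x y := by
        rw [bellGraph_adj]
        rcases x with _ | ⟨i, b⟩ <;> rcases y with _ | ⟨j, c⟩
        · exact absurd rfl he
        · simp only [bellBranch, Option.some.injEq] at hxy
          exact absurd hxy.symm (Fin.castSucc_ne_last j)
        · simp only [bellBranch, Option.some.injEq] at hxy
          exact absurd hxy (Fin.castSucc_ne_last i)
        · simp only [bellBranch, Option.some.injEq] at hxy
          obtain rfl : i = j := Fin.castSucc_injective _ hxy
          cases b <;> cases c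
          · exact absurd rfl he
          · simp [bellPart]
          · simp [bellPart]
          · exact absurd rfl he
      refine ⟨SimpleGraph.Walk.cons hadj SimpleGraph.Walk.nil, fun z hz => ?_⟩
      rw [SimpleGraph.Walk.support_cons, SimpleGraph.Walk.support_nil, List.mem_cons,
        List.mem_singleton] at hz
      rcases hz with rfl | rfl
      · rfl
      · exact hxy.symm
  · -- every edge of `K_{n+1}` is represented
    rw [SimpleGraph.top_adj] at huv
    rcases Fin.eq_castSucc_or_eq_last u with ⟨i, rfl⟩ | rfl <;>
      rcases Fin.eq_castSucc_or_eq_last v with ⟨j, rfl⟩ | rfl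
    · exact ⟨some (i, true), some (j, false), rfl, rfl, by simp [bellPart]⟩
    · exact ⟨some (i, true), none, rfl, rfl, by simp [bellPart]⟩
    · exact ⟨none, some (j, true), rfl, rfl, by simp [bellPart]⟩
    · exact absurd rfl huv

/-- **Avis–Tiwary Corollary 7** (explicit form): every extended formulation of the Bell inequality
polytope `CUT□(K_{1,n,n})` has size `r ≥ (3/2)ⁿ − 1` ("at least `2^{Ω(n)}`").
[cite: AvisTiwary2015, §4.1, Cor. 7 (arXiv p. 13, lit-read p0013 L36–43)] -/
theorem AvisTiwary2015_cor7 (n : ℕ) {r : ℕ} (h : HasEFOfSize (cutPolytope (bellGraph n)) r) :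
    (3 / 2 : ℝ) ^ n ≤ r + 1 :=
  AvisTiwary2015_cor6 (bellGraph n) (isMinor_top_bellGraph n) h

end Literature.Barriers.PneNP
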